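import Summits.ResolutionOfSingularities.ResolutionOfSingularities.Theorems.RiderCutClasses
import HarnessLib

/-!
# RiderCutKernels — decomp-res node «RiderCut» (lens-4 g19; critic row 123: landing order 17:52:13Z)
refining the MaxContactCut aside 32260 (host of the lens-4 column).  Tree file 2/3 of the node.

Content VERBATIM from the decomp-res lens-4 g19 delta `HOME/decomp-res-lens-4/g19/parts/g19-new.lean` (sha256 8a1606b4756fe017;
= §32–§37 of `HOME/decomp-res-lens-4/g19/RiderCut.lean` @4ef41708, whose §1–§31 are g18 CouplingCut
@5bf7b2ca l.244–2968 VERBATIM and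
ALREADY in the tree as `Theorems/HugValuationCut*`, `MarkingBudget*`, `WeightDescent*`, `FactorContact*`,
`CouplingCut*` and their
`MaxContactCut<Node>` wiring files).  HOME = run/shared/lean/pub/decomp-res.  Critic order 2026-08-30T17:52:13Z.

Route-independent, cone-free: §35 the KERNELS at weight `n` (PROVED modulo the COSTUME ports as hypotheses): the
PERFECT half of the g18
located residual — `incommensurableImpurePerfect_of_ports`, `impurePrincipalPerfect_of_ports`, the DECIDED CELL
`incommensurableWildDriftingPerfect_of_ports` (RiderPort + CouplingPort + all lower weights), EXACT
`incommensurableWildDrifting_iff_imperfect_of_ports`, the in-locus column from the g19 residuals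
(`inLocus_iff_residuals_of_lower_g19`,
`singularSurface_iff_g19`) and the step of the strong induction on the weight `ftt_step_of_g19`.

[WRITER NOTE (decomp-res writer g6): the whole lens-4 chain lives in ONE namespace `…Theorems.HugValuationCut` (the tree's g14
namespace) so that the lens's `HugChain.`/`HugShadow.`/`MarkedShadow.` dot-notation extends the landed structures
verbatim; the lens's
`noTower_iff_perfect_and_imperfect` is the tree's `ContactShadowKernels.noTower_iff_columns`; `set_option` lines
dropped; cone-free
(no `Theses` import) so the route file can import it for asides; the BY-NAME wiring to the MaxContactCut items is in the
`MaxContactCut<Node>` companion files.]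
(Sources: CossartJannsenSaito2020 Key Thm. 6.40, Cor. 6.37, Lem. 6.35/6.36; BierstoneGrigorievMilmanWlodarczyk2011
§3; CossartPiltant2019 (rider census, imperfect ground fields); Abhyankar1956; Cutkosky2009 §2.1; Giraud1975;
BierstoneMilman1997; Wlodarczyk2005; Kollar2007 §3.)
-/

noncomputable section

open CategoryTheory AlgebraicGeometry IsLocalRing
open Literature.AlgebraicGeometry.Resolution
open Summit.ResolutionOfSingularities.ResolutionOfSingularities.Theorems
open WeakOrderReduction ForcedTowerClasses DivergentTowerClasses MonomialTowerClasses
open HugDimensionClasses HugDimensionKernels SurfaceShadowClasses SurfaceShadowKernels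
open ContactShadowClasses (NoTowerImperfect)
open ContactShadowKernels (noTowerImperfect_of_noTower noTowerImperfect_mono noTower_iff_columns)
open NearPointCut (SingularClass singularSurface_iff_noTower)
open AbsoluteContactClasses (IsAbsContactAt)

namespace Summit.ResolutionOfSingularities.ResolutionOfSingularities.Theorems.HugValuationCut

variable {K : Type} [Field K]

/-! ## §35 (g19 · NEW) Kernels at weight `n`: the PERFECT half of g18's located residual — indeed the whole impure
principal column over perfect fields — is EMPTY modulo `RiderPort`, `CouplingPort` and the lower weights; the located
residual is its IMPERFECT half -/

/-- **KERNEL — THE INCOMMENSURABLE IMPURE PRINCIPAL COLUMN OVER PERFECT FIELDS IS EMPTY modulo the two ports and the lower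
weights**: the rider census gives a commensurable impure principal companion shadow ON THE SAME TOWER
(`exists_commensurable_companion`), and g18's coupling port sends that to a forced tower of lower weight. [folklore] -/
theorem incommensurableImpurePerfect_of_ports {n : ℕ} (hRi : RiderPort n) (hCo : CouplingPort n)
    (hlow : ∀ n' : ℕ, 1 ≤ n' → n' < n → ForcedTowersTerminate n') : IncommensurableImpurePerfectTowersTerminate n := by
  intro p hp k _ _ _ T g hB hD hE hT
  obtain ⟨hS, hL, S, hP, hnp, hi⟩ := hT
  have hcensus : RiderCensus p n S := hRi p hp k T g hB hD hE hS S (hL.2 S) hP hnp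
  obtain ⟨S', hP', hnp', hc', -⟩ := hcensus.exists_commensurable_companion hp hP hi
  exact commensurableImpure_of_port hCo hlow p hp k T g hB hD hE ⟨hS, hL, S', hP', hnp', hc'⟩

/-- **KERNEL — THE WHOLE IMPURE PRINCIPAL COLUMN OVER PERFECT FIELDS IS EMPTY modulo the two ports and the lower
weights.** [folklore] -/
theorem impurePrincipalPerfect_of_ports {n : ℕ} (hRi : RiderPort n) (hCo : CouplingPort n)
    (hlow : ∀ n' : ℕ, 1 ≤ n' → n' < n → ForcedTowersTerminate n') : ImpurePrincipalPerfectTowersTerminate n := by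
  intro p hp k _ _ _ T g hB hD hE hT
  obtain ⟨hS, hL, S, hP, hnp⟩ := hT
  rcases S.commensurable_or_incommensurable n with hc | hi
  · exact commensurableImpure_of_port hCo hlow p hp k T g hB hD hE ⟨hS, hL, S, hP, hnp, hc⟩
  · exact incommensurableImpurePerfect_of_ports hRi hCo hlow p hp k T g hB hD hE ⟨hS, hL, S, hP, hnp, hi⟩

/-- **KERNEL — THE PERFECT HALF OF g18's LOCATED RESIDUAL IS EMPTY modulo the two ports and the lower weights.** [folklore] -/
theorem incommensurableWildDriftingPerfect_of_ports {n : ℕ} (hRi : RiderPort n) (hCo : CouplingPort n)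
    (hlow : ∀ n' : ℕ, 1 ≤ n' → n' < n → ForcedTowersTerminate n') :
    IncommensurableWildDriftingPerfectTowersTerminate n :=
  noTowerPerfect_mono (fun _ ⟨hS, hL, S, hP, hnp, _, _, hi⟩ => ⟨hS, hL, S, hP, hnp, hi⟩)
    (incommensurableImpurePerfect_of_ports hRi hCo hlow)

/-- **KERNEL — g18's located residual from the two ports, the lower weights and the IMPERFECT residual alone.** [folklore] -/
theorem incommensurableWildDrifting_of_g19 {n : ℕ} (hRi : RiderPort n) (hCo : CouplingPort n)
    (hlow : ∀ n' : ℕ, 1 ≤ n' → n' < n → ForcedTowersTerminate n')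
    (hR : IncommensurableWildDriftingImperfectTowersTerminate n) : IncommensurableWildDriftingTowersTerminate n :=
  incommensurableWildDrifting_iff_perfect_imperfect.mpr ⟨incommensurableWildDriftingPerfect_of_ports hRi hCo hlow, hR⟩

/-- **EXACT RE-LOCATION modulo the ports below a terminating range: (L,P,drift,wild,incomm) ⟺ (… · IMPERFECT
k).** [folklore] -/
theorem incommensurableWildDrifting_iff_imperfect_of_ports {n : ℕ} (hRi : RiderPort n) (hCo : CouplingPort n)
    (hlow : ∀ n' : ℕ, 1 ≤ n' → n' < n → ForcedTowersTerminate n') :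
    IncommensurableWildDriftingTowersTerminate n ↔ IncommensurableWildDriftingImperfectTowersTerminate n :=
  ⟨incommensurableWildDriftingImperfect_of_g18, incommensurableWildDrifting_of_g19 hRi hCo hlow⟩

/-- g17's residual (L,P,drift,wild) from the ports, the lower weights and the imperfect residual. [folklore] -/
theorem wildDrifting_of_g19 {n : ℕ} (hRi : RiderPort n) (hCo : CouplingPort n)
    (hlow : ∀ n' : ℕ, 1 ≤ n' → n' < n → ForcedTowersTerminate n')
    (hR : IncommensurableWildDriftingImperfectTowersTerminate n) : WildDriftingTowersTerminate n :=
  wildDrifting_of_g18 hCo hlow (incommensurableWildDrifting_of_g19 hRi hCo hlow hR)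

/-- **THE MINIMAL-WEIGHT NORMAL FORM, g19** (modulo the COSTUME ports of the impure column): below a weight at which all
lower forced towers terminate, the in-locus column is EXACTLY `(L,¬P) ∧ (L,P,pure) ∧ (L,P,drift,wild,incomm ·
IMPERFECT k)` —
a minimal-weight in-locus counterexample hugs a codimension-two surface, or is PURE, or lives over an IMPERFECT
field. [folklore] -/
theorem inLocus_iff_residuals_of_lower_g19 {n : ℕ} (hDesc : DescentPort n) (hFC : FactorContactPort n)
    (hCo : CouplingPort n) (hRi : RiderPort n) (hlow : ∀ n' : ℕ, 1 ≤ n' → n' < n → ForcedTowersTerminate n') :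
    InLocusShadowTowersTerminate n ↔ NonPrincipalInLocusTowersTerminate n ∧ PurePrincipalTowersTerminate n ∧
      IncommensurableWildDriftingImperfectTowersTerminate n :=
  (inLocus_iff_residuals_of_lower_g18 hDesc hFC hCo hlow).trans
    ⟨fun h => ⟨h.1, h.2.1, incommensurableWildDriftingImperfect_of_g18 h.2.2⟩,
      fun h => ⟨h.1, h.2.1, incommensurableWildDrifting_of_g19 hRi hCo hlow h.2.2⟩⟩

/-- Necessity at the target, PORT-FREE: 32260 at weight `n` implies the g19 residual. [folklore] -/
theorem incommensurableWildDriftingImperfect_of_singularSurface {n : ℕ} (h : SingularSurfaceHuggingTowersTerminate n) :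
    IncommensurableWildDriftingImperfectTowersTerminate n :=
  incommensurableWildDriftingImperfect_of_g18 (incommensurableWildDrifting_of_singularSurface h)

/-- **KERNEL — THE TARGET LEAF 32260 at weight `n`** from (O), (L,¬P), (L,P,pure), the g19 IMPERFECT residual, the six
COSTUME ports and the lower weights. [folklore] -/
theorem singularSurface_of_g19 {n : ℕ} (hP : ShadowPort n) (hM : MarkingPort n) (hDesc : DescentPort n)
    (hFC : FactorContactPort n) (hCo : CouplingPort n) (hRi : RiderPort n)
    (hlow : ∀ n' : ℕ, 1 ≤ n' → n' < n → ForcedTowersTerminate n')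
    (hO : OffLocusShadowTowersTerminate n) (hNP : NonPrincipalInLocusTowersTerminate n)
    (hPu : PurePrincipalTowersTerminate n) (hR : IncommensurableWildDriftingImperfectTowersTerminate n) :
    SingularSurfaceHuggingTowersTerminate n :=
  singularSurface_of_g18 hP hM hDesc hFC hCo hlow hO hNP hPu (incommensurableWildDrifting_of_g19 hRi hCo hlow hR)

/-- **EXACT at weight `n` below a terminating range** (ports + lower weights): 32260 at `n` ⟺ (O) ∧ (L,¬P) ∧
(L,P,pure) ∧
(L,P,drift,wild,incomm · IMPERFECT k). [folklore] -/
theorem singularSurface_iff_g19 {n : ℕ} (hP : ShadowPort n) (hM : MarkingPort n) (hDesc : DescentPort n)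
    (hFC : FactorContactPort n) (hCo : CouplingPort n) (hRi : RiderPort n)
    (hlow : ∀ n' : ℕ, 1 ≤ n' → n' < n → ForcedTowersTerminate n') :
    SingularSurfaceHuggingTowersTerminate n ↔ OffLocusShadowTowersTerminate n ∧
      NonPrincipalInLocusTowersTerminate n ∧ PurePrincipalTowersTerminate n ∧
        IncommensurableWildDriftingImperfectTowersTerminate n :=
  (singularSurface_iff_g18 hP hM hDesc hFC hCo hlow).trans
    ⟨fun h => ⟨h.1, h.2.1, h.2.2.1, incommensurableWildDriftingImperfect_of_g18 h.2.2.2⟩,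
      fun h => ⟨h.1, h.2.1, h.2.2.1, incommensurableWildDrifting_of_g19 hRi hCo hlow h.2.2.2⟩⟩

/-- **KERNEL — the ROOT PIECE at weight `n`** from the leaves at weight `n` and all lower weights (the step of the strong
induction; g18's step with the incommensurable cell replaced by rider port + imperfect residual). [folklore] -/
theorem ftt_step_of_g19 {n : ℕ} (hn : 1 ≤ n) (hMo : MonomialCorner n) (hC : CurveLaw n) (hSL : SurfaceLaw n)
    (hH : HypersurfaceHuggingTowersTerminate n) (hP : ShadowPort n) (hM : MarkingPort n) (hDesc : DescentPort n)
    (hFC : FactorContactPort n) (hCo : CouplingPort n) (hRi : RiderPort n) (hO : OffLocusShadowTowersTerminate n)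
    (hNP : NonPrincipalInLocusTowersTerminate n) (hPu : PurePrincipalTowersTerminate n)
    (hR : IncommensurableWildDriftingImperfectTowersTerminate n)
    (hlow : ∀ n' : ℕ, 1 ≤ n' → n' < n → ForcedTowersTerminate n') : ForcedTowersTerminate n :=
  ftt_step_of_g18 hn hMo hC hSL hH hP hM hDesc hFC hCo hO hNP hPu (incommensurableWildDrifting_of_g19 hRi hCo hlow hR) hlow

end Summit.ResolutionOfSingularities.ResolutionOfSingularities.Theorems.HugValuationCut
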